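import Summits.AtomisticToContinuum.HydrodynamicLimit.Theorems.OneFlightGossipEngineClampedTransferDockBridgeDefs
import HarnessLib

/-!
# Static drift tails of the local Gibbs law (support `localGibbs_driftBad_fraction_small`)

Crux `Summit.AtomisticToContinuum.HydrodynamicLimit.Theses.OneFlightGossipEngine.ClampedTransferDock` (stmt-AtomisticToContinuum-16665), line `Sketch`:
the TIME-ZERO instance of the conjecture-grade static drift price `MesoDriftTails` (`stub_mesoDriftTails`), where the law is the explicit local Gibbs
law and the drift test is against `u₀`. CLAIM: for continuous `a₀, θ₀ > 0`, `u₀`, `σ < 1/2`, `D₀ > 0`, with `r₀ = r₀(D₀, u₀) ≤ 1` a radius below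
which `u₀` oscillates by `≤ D₀/2`, the local-Gibbs mean fraction of DRIFT-BAD particles is `≤ ε` once `κ ≥ max(1, (250 + 216 Θ/D₀²)/ε)`,
`Θ = sup θ₀`, for EVERY `N`. PROOF: (1) bias/fluctuation split (`norm_ballMeanVel_sub_le`): ball mean minus `u₀(x_i)` = ball average of
`u₀(x_j) − u₀(x_i)` (norm `≤ D₀/2` below `r₀`) + ball average `F` of the peculiar velocities `v_j − u₀(x_j)`; so a drift-bad particle has, at some
admissible scale `k`, a SPARSE ball (`ballCount < κ²4^k`, event `sparseEvt`) or `‖F‖ > D₀/2` with `≥ κ²4^k` members (`fluctEvt`) — `ite_driftBad_le`.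
(2) Sparse balls are few, deterministically (`card_ballCount_lt_le`): pigeonhole over the `r/2`-cells of `Torus.coarseCell` (a cell lies in the
`r`-ball of each of its points; `≤ 125/r³` cells): sparse fraction `≤ 125/(κ2^k)`. (3) Fluctuations are rare (`measure_fluctBad_le`): given the
positions the velocities are independent Gaussians (`lintegral_localGibbsMeasure`), the ball is frozen; Bienaymé–Chebyshev per coordinate
(`pi_gauss_sum_ge_le`): probability `≤ 108 Θ/(κ²4^k D₀²)`. (4) Union bound + Tonelli (`lintegral_ofReal_le_of_indicator_bound`): mean fraction
`≤ Σ_k [125/(κ2^k) + 108Θ/(κ²4^k D₀²)] ≤ (250 + 216 Θ/D₀²)/κ` for `κ ≥ 1`. prover-line-stmt-AtomisticToContinuum-16665-0 (stub worker, line Sketch).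
-/

noncomputable section

namespace Summit.AtomisticToContinuum.HydrodynamicLimit.Theorems.ClampedTransferDockBridge

open scoped BigOperators ENNReal Classical
open MeasureTheory ProbabilityTheory Set Filter
open Literature.MathematicalPhysics.KineticTheory Literature.Analysis.FluidPDE Literature.Analysis.FunctionSpaces

variable {N : ℕ}

/-- The index set of the ball of (minimal-image) radius `r` around particle `i`. -/
def ballSet (r : ℝ) (c : Config (N + 1) (Fin 3) T3) (i : Fin (N + 1)) : Finset (Fin (N + 1)) :=
  Finset.univ.filter (fun j : Fin (N + 1) => Torus.euclidDist (c j).1 (c i).1 ≤ r)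

/-- The ball FLUCTUATION: the ball average of the peculiar velocities `v_j − u₀(x_j)`. -/
def ballFluct (u₀ : T3 → V3) (r : ℝ) (c : Config (N + 1) (Fin 3) T3) (i : Fin (N + 1)) : V3 :=
  ((ballCount r c i : ℝ)⁻¹) • ∑ j ∈ ballSet r c i, ((c j).2 - u₀ (c j).1)

/-- **Bias/fluctuation split.** If `u₀` oscillates by `≤ b` over distance `r ≥ 0`: `‖ball mean − u₀(x_i)‖ ≤ b + ‖ball fluctuation‖` (the ball contains `i`). -/
theorem norm_ballMeanVel_sub_le {u₀ : T3 → V3} {r b : ℝ} (hr : 0 ≤ r) (hb : ∀ x y : T3, Torus.euclidDist x y ≤ r → ‖u₀ x - u₀ y‖ ≤ b)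
    (c : Config (N + 1) (Fin 3) T3) (i : Fin (N + 1)) : ‖ballMeanVel r c i - u₀ (c i).1‖ ≤ b + ‖ballFluct u₀ r c i‖ := by
  set B := ballSet r c i with hB
  set n : ℝ := (ballCount r c i : ℝ) with hn
  have hn1 : (1 : ℝ) ≤ n := by rw [hn]; exact_mod_cast Nat.succ_le_of_lt (Finset.card_pos.2 ⟨i, by simp [Torus.euclidDist_self, hr]⟩)
  have hn0 : n ≠ 0 := by positivity
  have hcard : (B.card : ℝ) = n := by rw [hn]; rfl
  have key : ballMeanVel r c i - u₀ (c i).1 = n⁻¹ • ∑ j ∈ B, (u₀ (c j).1 - u₀ (c i).1) + ballFluct u₀ r c i := by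
    have e1 : ballMeanVel r c i = n⁻¹ • ∑ j ∈ B, (c j).2 := rfl
    have e3 : ∑ j ∈ B, ((u₀ (c j).1 - u₀ (c i).1) + ((c j).2 - u₀ (c j).1)) = ∑ j ∈ B, (c j).2 - B.card • u₀ (c i).1 := by
      rw [← Finset.sum_const, ← Finset.sum_sub_distrib]; exact Finset.sum_congr rfl fun j _ => by abel
    rw [e1, ballFluct, ← smul_add, ← Finset.sum_add_distrib, e3, smul_sub, ← Nat.cast_smul_eq_nsmul ℝ, smul_smul, hcard, inv_mul_cancel₀ hn0, one_smul]
  rw [key]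
  refine (norm_add_le _ _).trans (add_le_add ?_ le_rfl)
  rw [norm_smul, norm_inv, Real.norm_of_nonneg (by positivity : (0 : ℝ) ≤ n)]
  calc n⁻¹ * ‖∑ j ∈ B, (u₀ (c j).1 - u₀ (c i).1)‖ ≤ n⁻¹ * ∑ j ∈ B, b :=
        mul_le_mul_of_nonneg_left ((norm_sum_le _ _).trans (Finset.sum_le_sum fun j hj => hb _ _ (Finset.mem_filter.1 hj).2)) (by positivity)
    _ = b := by rw [Finset.sum_const, nsmul_eq_mul, hcard, ← mul_assoc, inv_mul_cancel₀ hn0, one_mul]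

/-- The dyadic test radius `r_k = κ (N+1)^{-1/3} 2^k` of `DriftBad`. -/
def rad (κ : ℝ) (N k : ℕ) : ℝ := κ * ((N : ℝ) + 1) ^ (-(1 / 3 : ℝ)) * 2 ^ k

/-- `r_k³ = κ³ (N+1)⁻¹ 8^k`. -/
theorem rad_pow_three (κ : ℝ) (N k : ℕ) : rad κ N k ^ 3 = κ ^ 3 * ((N : ℝ) + 1)⁻¹ * 8 ^ k := by
  have h1 : (((N : ℝ) + 1) ^ (-(1 / 3 : ℝ))) ^ 3 = ((N : ℝ) + 1)⁻¹ := by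
    rw [← Real.rpow_natCast _ 3, ← Real.rpow_mul (by positivity)]; norm_num [Real.rpow_neg_one]
  have h2 : ((2 : ℝ) ^ k) ^ 3 = 8 ^ k := by rw [← pow_mul, mul_comm, pow_mul]; norm_num
  rw [rad, mul_pow, mul_pow, h1, h2]

/-- Only finitely many dyadic scales are admissible: `r_k ≤ r₀ ⇒ k < K` for some `K = K(κ, N, r₀)`. -/
theorem exists_scaleBound {κ : ℝ} (hκ : 0 < κ) (N : ℕ) (r₀ : ℝ) : ∃ K : ℕ, ∀ k, rad κ N k ≤ r₀ → k < K := by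
  obtain ⟨K, hK⟩ := exists_nat_ge (r₀ / (κ * ((N : ℝ) + 1) ^ (-(1 / 3 : ℝ))))
  refine ⟨K, fun k hk => ?_⟩
  have hc : 0 < κ * ((N : ℝ) + 1) ^ (-(1 / 3 : ℝ)) := by positivity
  have h2 : (2 : ℝ) ^ k ≤ r₀ / (κ * ((N : ℝ) + 1) ^ (-(1 / 3 : ℝ))) := by rw [le_div_iff₀ hc]; unfold rad at hk; linarith
  have h3 : (k : ℝ) < 2 ^ k := by exact_mod_cast Nat.lt_two_pow_self
  exact_mod_cast (h3.trans_le (h2.trans hK) : (k : ℝ) < K)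

/-- The event "scale `k` is admissible and the `r_k`-ball of particle `i` is SPARSE (`< κ²4^k` members)". -/
def sparseEvt (κ r₀ : ℝ) (N k : ℕ) (i : Fin (N + 1)) : Set (Config (N + 1) (Fin 3) T3) :=
  {c | rad κ N k ≤ r₀ ∧ (ballCount (rad κ N k) c i : ℝ) < κ ^ 2 * 4 ^ k}

/-- The event "the `r_k`-ball of particle `i` has `≥ κ²4^k` members and its velocity fluctuation exceeds `D₀/2`". -/
def fluctEvt (κ D₀ : ℝ) (u₀ : T3 → V3) (N k : ℕ) (i : Fin (N + 1)) : Set (Config (N + 1) (Fin 3) T3) :=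
  {c | κ ^ 2 * 4 ^ k ≤ (ballCount (rad κ N k) c i : ℝ) ∧ D₀ / 2 < ‖ballFluct u₀ (rad κ N k) c i‖}

/-- **Pointwise reduction.** If `u₀` oscillates by `≤ D₀/2` below `r₀` and every admissible scale is `< K`: `1{DriftBad i} ≤ Σ_{k<K} (1_{sparseEvt} + 1_{fluctEvt})`. -/
theorem ite_driftBad_le {κ r₀ D₀ : ℝ} {u₀ : T3 → V3} (hκ : 0 < κ) (hb : ∀ x y : T3, Torus.euclidDist x y ≤ r₀ → ‖u₀ x - u₀ y‖ ≤ D₀ / 2)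
    {K : ℕ} (hK : ∀ k, rad κ N k ≤ r₀ → k < K) (c : Config (N + 1) (Fin 3) T3) (i : Fin (N + 1)) :
    (if DriftBad κ r₀ D₀ u₀ c i then (1 : ℝ) else 0) ≤ ∑ k ∈ Finset.range K, ((sparseEvt κ r₀ N k i).indicator 1 c + (fluctEvt κ D₀ u₀ N k i).indicator 1 c) := by
  have h0 : ∀ k, (0 : ℝ) ≤ (sparseEvt κ r₀ N k i).indicator 1 c ∧ (0 : ℝ) ≤ (fluctEvt κ D₀ u₀ N k i).indicator 1 c :=
    fun k => ⟨Set.indicator_nonneg (fun _ _ => zero_le_one) _, Set.indicator_nonneg (fun _ _ => zero_le_one) _⟩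
  split_ifs with h
  · obtain ⟨k, hk, hD⟩ := h
    change D₀ < ‖ballMeanVel (rad κ N k) c i - u₀ (c i).1‖ at hD
    have hfl : D₀ / 2 < ‖ballFluct u₀ (rad κ N k) c i‖ := by
      linarith [norm_ballMeanVel_sub_le (by unfold rad; positivity : 0 < rad κ N k).le (fun x y hxy => hb x y (hxy.trans hk)) c i]
    refine le_trans ?_ (Finset.single_le_sum (fun k _ => add_nonneg (h0 k).1 (h0 k).2) (Finset.mem_range.2 (hK k hk)))
    by_cases hm : (ballCount (rad κ N k) c i : ℝ) < κ ^ 2 * 4 ^ k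
    · rw [Set.indicator_of_mem (show c ∈ sparseEvt κ r₀ N k i from ⟨hk, hm⟩), Pi.one_apply]; linarith [(h0 k).2]
    · rw [Set.indicator_of_mem (show c ∈ fluctEvt κ D₀ u₀ N k i from ⟨not_lt.1 hm, hfl⟩), Pi.one_apply]; linarith [(h0 k).1]
  · exact Finset.sum_nonneg fun k _ => add_nonneg (h0 k).1 (h0 k).2

/-- Two points of `𝕋³` in the same `r/2`-cell of `Torus.coarseCell` are within minimal-image distance `r`. -/
theorem euclidDist_le_of_coarseCell_eq {r : ℝ} (hr : 0 < r) {x y : T3} (h : Torus.coarseCell (r / 2) x = Torus.coarseCell (r / 2) y) :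
    Torus.euclidDist x y ≤ r := by
  -- adapted from `InformationPercolationEngineKickFairRelEquilibriumMesoBinOscillation.dist_lt_of_coarseCell_eq`
  have hsup : ‖x - y‖ ≤ r / 2 := by
    refine (pi_norm_le_iff_of_nonneg (by positivity)).2 fun l => ?_
    have h1 : |Torus.reprSym x l / (r / 2) - Torus.reprSym y l / (r / 2)| < 1 := Int.abs_sub_lt_one_of_floor_eq_floor (congr_fun h l)
    rw [← sub_div, abs_div, abs_of_pos (half_pos hr), div_lt_one (half_pos hr)] at h1
    have hx : ((Torus.reprSym x l : ℝ) : UnitAddCircle) = x l := congr_fun (Torus.proj_reprSym x) l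
    have hy : ((Torus.reprSym y l : ℝ) : UnitAddCircle) = y l := congr_fun (Torus.proj_reprSym y) l
    rw [Pi.sub_apply, ← hx, ← hy, ← AddCircle.coe_sub]
    exact QuotientAddGroup.norm_mk_le_norm.trans (by rw [Real.norm_eq_abs]; exact h1.le)
  have h3 : Real.sqrt (Fintype.card (Fin 3)) ≤ 2 := by rw [Fintype.card_fin]; exact Real.sqrt_le_iff.2 ⟨by norm_num, by norm_num⟩
  calc Torus.euclidDist x y ≤ Real.sqrt (Fintype.card (Fin 3)) * ‖x - y‖ := Torus.euclidDist_le_holds x y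
    _ ≤ 2 * (r / 2) := mul_le_mul h3 hsup (norm_nonneg _) zero_le_two
    _ = r := by ring

/-- Every `r/2`-cell index lies in the box `[-⌈1/r⌉₊, ⌈1/r⌉₊]³` (the symmetric representative has coordinates in `(-1/2, 1/2]`). -/
theorem coarseCell_mem_box {r : ℝ} (hr : 0 < r) (x : T3) :
    Torus.coarseCell (r / 2) x ∈ Fintype.piFinset fun _ : Fin 3 => Finset.Icc (-(⌈1 / r⌉₊ : ℤ)) ⌈1 / r⌉₊ := by
  -- adapted from `InformationPercolationEngineKickFairRelEquilibriumMesoKeyCount.coarseCell_mem_box`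
  refine Fintype.mem_piFinset.2 fun l => ?_
  have hmem := Torus.reprSym_apply_mem_Ioc x l
  have hc : 1 / r ≤ (⌈1 / r⌉₊ : ℝ) := Nat.le_ceil _
  have hq : |Torus.reprSym x l / (r / 2)| ≤ 1 / r := by
    rw [abs_div, abs_of_pos (half_pos hr), div_le_iff₀ (half_pos hr), show 1 / r * (r / 2) = 1 / 2 by field_simp]
    exact abs_le.2 ⟨by linarith [hmem.1], hmem.2⟩
  refine Finset.mem_Icc.2 ⟨Int.le_floor.2 ?_, Int.floor_le_iff.2 ?_⟩ <;> push_cast <;> linarith [(abs_le.1 hq).1, (abs_le.1 hq).2]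

/-- The box `[-⌈1/r⌉₊, ⌈1/r⌉₊]³` has at most `125/r³` cells (`0 < r ≤ 1`). -/
theorem card_box_le {r : ℝ} (hr : 0 < r) (hr1 : r ≤ 1) : ((Fintype.piFinset fun _ : Fin 3 => Finset.Icc (-(⌈1 / r⌉₊ : ℤ)) ⌈1 / r⌉₊).card : ℝ) ≤ 125 / r ^ 3 := by
  set L : ℕ := ⌈1 / r⌉₊
  have hL : (L : ℝ) < 1 / r + 1 := Nat.ceil_lt_add_one (by positivity)
  have hI : ((Finset.Icc (-(L : ℤ)) L).card : ℝ) = 2 * L + 1 := by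
    rw [Int.card_Icc, show (L : ℤ) + 1 - -(L : ℤ) = ((2 * L + 1 : ℕ) : ℤ) by push_cast; ring, Int.toNat_natCast]; push_cast; ring
  rw [Fintype.card_piFinset, Finset.prod_const, Finset.card_univ, Fintype.card_fin, Nat.cast_pow, hI]
  have h3 : (3 : ℝ) ≤ 3 / r := by rw [le_div_iff₀ hr]; nlinarith
  have h5 : 2 * (L : ℝ) + 1 ≤ 5 / r := by linarith [show 2 * (1 / r) = 2 / r by ring, show 2 / r + 3 / r = 5 / r by ring]
  calc (2 * (L : ℝ) + 1) ^ 3 ≤ (5 / r) ^ 3 := pow_le_pow_left₀ (by positivity) h5 3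
    _ = 125 / r ^ 3 := by rw [div_pow]; norm_num

/-- **Sparse balls are few (pigeonhole).** For `0 < r ≤ 1` and `m ≥ 0`, at most `125 m / r³` particles have fewer than `m` particles in their
`r`-ball: the `r`-ball of a particle contains its whole `r/2`-cell, and the cells of occupancy `< m` (`≤ 125/r³` of them) hold `< m` particles each. -/
theorem card_ballCount_lt_le {r m : ℝ} (hr : 0 < r) (hr1 : r ≤ 1) (hm : 0 ≤ m) (c : Config (N + 1) (Fin 3) T3) :
    ((Finset.univ.filter fun i : Fin (N + 1) => (ballCount r c i : ℝ) < m).card : ℝ) ≤ 125 / r ^ 3 * m := by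
  set box := Fintype.piFinset fun _ : Fin 3 => Finset.Icc (-(⌈1 / r⌉₊ : ℤ)) ⌈1 / r⌉₊ with hbox
  set cell : Fin (N + 1) → (Fin 3 → ℤ) := fun i => Torus.coarseCell (r / 2) (c i).1 with hcell
  set occ : (Fin 3 → ℤ) → ℕ := fun e => (Finset.univ.filter fun j : Fin (N + 1) => cell j = e).card with hoccdef
  set S' := Finset.univ.filter fun i : Fin (N + 1) => (occ (cell i) : ℝ) < m with hS'
  have hocc : ∀ i, occ (cell i) ≤ ballCount r c i := fun i => Finset.card_le_card fun j hj => by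
    simp only [Finset.mem_filter, Finset.mem_univ, true_and] at hj ⊢; exact euclidDist_le_of_coarseCell_eq hr hj
  have hsub : (Finset.univ.filter fun i : Fin (N + 1) => (ballCount r c i : ℝ) < m) ⊆ S' := fun i hi => by
    simp only [hS', Finset.mem_filter, Finset.mem_univ, true_and] at hi ⊢; exact lt_of_le_of_lt (by exact_mod_cast hocc i) hi
  have hfib : S'.card = ∑ e ∈ box, (S'.filter fun i => cell i = e).card := Finset.card_eq_sum_card_fiberwise fun i _ => coarseCell_mem_box hr (c i).1
  have hle : ∀ e ∈ box, (((S'.filter fun i => cell i = e).card : ℕ) : ℝ) ≤ m := by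
    intro e _; by_cases he : (occ e : ℝ) < m
    · exact le_trans (by exact_mod_cast Finset.card_le_card fun i hi => by simp only [Finset.mem_filter, Finset.mem_univ, true_and] at hi ⊢; exact hi.2) he.le
    · rw [Finset.card_eq_zero.2 (Finset.filter_eq_empty_iff.2 fun i hi hie => he ?_), Nat.cast_zero]
      · exact hm
      · simp only [hS', Finset.mem_filter, Finset.mem_univ, true_and] at hi; rwa [hie] at hi
  calc ((Finset.univ.filter fun i : Fin (N + 1) => (ballCount r c i : ℝ) < m).card : ℝ) ≤ S'.card := by exact_mod_cast Finset.card_le_card hsub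
    _ = ∑ e ∈ box, (((S'.filter fun i => cell i = e).card : ℕ) : ℝ) := by rw [hfib]; push_cast; rfl
    _ ≤ ∑ e ∈ box, m := Finset.sum_le_sum hle
    _ = box.card * m := by rw [Finset.sum_const, nsmul_eq_mul]
    _ ≤ 125 / r ^ 3 * m := mul_le_mul_of_nonneg_right (card_box_le hr hr1) hm

/-- The admissible-and-sparse count at scale `k`: `Σ_i 1_{sparseEvt} ≤ (N+1) · 125/(κ 2^k)` (`r₀ ≤ 1`; `125 κ²4^k / r_k³ = 125 (N+1)/(κ2^k)`). -/
theorem sum_indicator_sparse_le {κ r₀ : ℝ} (hκ : 0 < κ) (hr₀1 : r₀ ≤ 1) (N k : ℕ) (c : Config (N + 1) (Fin 3) T3) :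
    ∑ i : Fin (N + 1), (sparseEvt κ r₀ N k i).indicator 1 c ≤ ((N : ℝ) + 1) * (125 / (κ * 2 ^ k)) := by
  by_cases hk : rad κ N k ≤ r₀
  · have h8 : (8 : ℝ) ^ k = 2 ^ k * 4 ^ k := by rw [← mul_pow]; norm_num
    calc ∑ i : Fin (N + 1), (sparseEvt κ r₀ N k i).indicator 1 c = ∑ i : Fin (N + 1), (if (ballCount (rad κ N k) c i : ℝ) < κ ^ 2 * 4 ^ k then (1 : ℝ) else 0) :=
          Finset.sum_congr rfl fun i _ => by simp [sparseEvt, Set.indicator_apply, hk]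
      _ = ((Finset.univ.filter fun i : Fin (N + 1) => (ballCount (rad κ N k) c i : ℝ) < κ ^ 2 * 4 ^ k).card : ℝ) := (Finset.natCast_card_filter _ _).symm
      _ ≤ 125 / rad κ N k ^ 3 * (κ ^ 2 * 4 ^ k) := card_ballCount_lt_le (by unfold rad; positivity) (hk.trans hr₀1) (by positivity) c
      _ = ((N : ℝ) + 1) * (125 / (κ * 2 ^ k)) := by rw [rad_pow_three, h8]; field_simp
  · simp [sparseEvt, hk]; positivity

/-- **Chebyshev for a partial sum of independent Gaussian coordinates.** Under `⊗_j N(u_j, θ_j I₃)` with `0 < θ_j ≤ Θ`, for a nonempty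
index set `B` and a coordinate `l`: `P(|B| δ ≤ |Σ_{j∈B} (v_{jl} − u_{jl})|) ≤ Θ / (|B| δ²)`. -/
theorem pi_gauss_sum_ge_le {n : ℕ} (u : Fin n → V3) (θ : Fin n → ℝ) {Θ : ℝ} (hθ0 : ∀ j, 0 < θ j) (hθ : ∀ j, θ j ≤ Θ) {B : Finset (Fin n)}
    (hB : B.Nonempty) (l : Fin 3) {δ : ℝ} (hδ : 0 < δ) :
    Measure.pi (fun j => gaussMeasure (u j) (θ j)) {v | (B.card : ℝ) * δ ≤ |∑ j ∈ B, (v j l - u j l)|} ≤ ENNReal.ofReal (Θ / (B.card * δ ^ 2)) := by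
  -- adapted from `Literature.MathematicalPhysics.KineticTheory.pi_measure_avg_ge_le` (Bienaymé–Chebyshev on the product space)
  set μ : Fin n → Measure V3 := fun j => gaussMeasure (u j) (θ j) with hμ
  set X : Fin n → V3 → ℝ := fun j w => if j ∈ B then w l - u j l else 0 with hX
  have hXin : ∀ j ∈ B, X j = fun w => w l - u j l := fun j hj => by funext w; simp [hX, hj]
  have hXout : ∀ j ∉ B, X j = 0 := fun j hj => by funext w; simp [hX, hj]
  have hc2 : ∀ j, MemLp (fun w : V3 => w l - u j l) 2 (μ j) := fun j => (memLp_coord_gaussMeasure (u j) (θ j) l 2 (by simp)).sub (memLp_const _)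
  have hX2 : ∀ j, MemLp (X j) 2 (μ j) := fun j => by
    by_cases hj : j ∈ B
    · rw [hXin j hj]; exact hc2 j
    · rw [hXout j hj]; exact memLp_const 0
  have hX0 : ∀ j, ∫ w, X j w ∂μ j = 0 := fun j => by
    by_cases hj : j ∈ B
    · simp only [hXin j hj]
      rw [integral_sub ((memLp_coord_gaussMeasure (u j) (θ j) l 2 (by simp)).integrable one_le_two) (integrable_const _), integral_coord_gaussMeasure _ (hθ0 j), integral_const]; simp
    · simp [hXout j hj]
  have hXv : ∀ j, Var[X j; μ j] ≤ if j ∈ B then Θ else 0 := fun j => by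
    by_cases hj : j ∈ B
    · simp only [hXin j hj, hj, if_true]; rw [variance_sub_const (by fun_prop : Continuous fun w : V3 => w l).aestronglyMeasurable, variance_coord_gaussMeasure _ (hθ0 j).le]; exact hθ j
    · simp [hXout j hj, variance_zero, hj]
  set S : (Fin n → V3) → ℝ := ∑ j, fun v => X j (v j) with hS
  have happ : ∀ v, S v = ∑ j, X j (v j) := fun v => by simp [hS]
  have hSapply : ∀ v, S v = ∑ j ∈ B, (v j l - u j l) := fun v => by rw [happ]; simp only [hX]; rw [Finset.sum_ite_mem, Finset.univ_inter]
  have hSi : ∀ j, MemLp (fun v : Fin n → V3 => X j (v j)) 2 (Measure.pi μ) := fun j => (hX2 j).comp_measurePreserving (measurePreserving_eval μ j)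
  have hSm : MemLp S 2 (Measure.pi μ) := memLp_finsetSum' _ fun j _ => hSi j
  have hmean : ∫ v, S v ∂Measure.pi μ = 0 := by
    simp_rw [happ]
    rw [integral_finsetSum _ fun j _ => (hSi j).integrable one_le_two]
    refine Finset.sum_eq_zero fun j _ => ?_
    have h := integral_map (μ := Measure.pi μ) (measurable_pi_apply j).aemeasurable (f := X j)
      (by rw [(measurePreserving_eval μ j).map_eq]; exact (hX2 j).aestronglyMeasurable)
    rw [(measurePreserving_eval μ j).map_eq] at h; rw [← h, hX0 j]
  have hvar : Var[S; Measure.pi μ] ≤ B.card * Θ := by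
    rw [hS, variance_sum_pi hX2]
    calc ∑ j, Var[X j; μ j] ≤ ∑ j, (if j ∈ B then Θ else 0) := Finset.sum_le_sum fun j _ => hXv j
      _ = B.card * Θ := by rw [Finset.sum_ite_mem, Finset.univ_inter, Finset.sum_const, nsmul_eq_mul]
  have hcard : (0 : ℝ) < B.card := by exact_mod_cast hB.card_pos
  calc Measure.pi μ {v | (B.card : ℝ) * δ ≤ |∑ j ∈ B, (v j l - u j l)|} = Measure.pi μ {v | (B.card : ℝ) * δ ≤ |S v - ∫ w, S w ∂Measure.pi μ|} := by
        simp_rw [hmean, sub_zero, hSapply]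
    _ ≤ ENNReal.ofReal (Var[S; Measure.pi μ] / ((B.card : ℝ) * δ) ^ 2) := meas_ge_le_variance_div_sq hSm (by positivity)
    _ ≤ ENNReal.ofReal (Θ / (B.card * δ ^ 2)) := by
        refine ENNReal.ofReal_le_ofReal ?_
        rw [div_le_div_iff₀ (by positivity) (by positivity)]
        calc Var[S; Measure.pi μ] * (B.card * δ ^ 2) ≤ B.card * Θ * (B.card * δ ^ 2) := mul_le_mul_of_nonneg_right hvar (by positivity)
          _ = Θ * ((B.card : ℝ) * δ) ^ 2 := by ring

/-- The ball fluctuation is a measurable configuration functional (continuous `u₀`). -/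
theorem measurable_ballFluct {u₀ : T3 → V3} (hu : Continuous u₀) (r : ℝ) (i : Fin (N + 1)) : Measurable fun c : Config (N + 1) (Fin 3) T3 => ballFluct u₀ r c i := by
  have e : ∀ c : Config (N + 1) (Fin 3) T3, ballFluct u₀ r c i =
      ((ballCount r c i : ℝ)⁻¹) • ∑ j : Fin (N + 1), (if Torus.euclidDist (c j).1 (c i).1 ≤ r then (c j).2 - u₀ (c j).1 else 0) := fun c => by
    rw [ballFluct, ballSet, Finset.sum_filter]
  simp_rw [e]
  refine (measurable_ballCount r i).inv.smul (Finset.measurable_sum _ fun j _ => ?_)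
  exact Measurable.ite (measurableSet_ball_mem r i j) ((measurable_pi_apply j).snd.sub (hu.measurable.comp (measurable_pi_apply j).fst)) measurable_const

/-- The event "`≥ m` members and fluctuation `> D`" is measurable. -/
theorem measurableSet_fluctBad {u₀ : T3 → V3} (hu : Continuous u₀) (r m D : ℝ) (i : Fin (N + 1)) :
    MeasurableSet {c : Config (N + 1) (Fin 3) T3 | m ≤ (ballCount r c i : ℝ) ∧ D < ‖ballFluct u₀ r c i‖} :=
  (measurableSet_le measurable_const (measurable_ballCount r i)).inter (measurableSet_lt measurable_const (measurable_ballFluct hu r i).norm)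

variable {a₀ θ₀ : T3 → ℝ} {u₀ : T3 → V3}

/-- **Fluctuations are rare.** Under the local Gibbs measure, `P(ballCount ≥ m ∧ ‖ball fluctuation‖ > D/2) ≤ 108 Θ / (m D²)` (`m > 0`, `Θ ≥ sup θ₀`): given the
positions (`lintegral_localGibbsMeasure`) the ball is frozen and the velocities are independent Gaussians; union bound over coordinates + `pi_gauss_sum_ge_le`. -/
theorem measure_fluctBad_le (ha : Continuous a₀) (hθ : Continuous θ₀) (hu : Continuous u₀) (ha0 : ∀ x, 0 ≤ a₀ x) (hθ0 : ∀ x, 0 < θ₀ x) {Θ : ℝ}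
    (hΘ : ∀ x, θ₀ x ≤ Θ) (σ : ℝ) (N : ℕ) [IsProbabilityMeasure (localGibbsMeasure σ a₀ u₀ θ₀ N)] (r : ℝ) {m D : ℝ} (hm : 0 < m) (hD : 0 < D) (i : Fin (N + 1)) :
    localGibbsMeasure σ a₀ u₀ θ₀ N {c | m ≤ (ballCount r c i : ℝ) ∧ D / 2 < ‖ballFluct u₀ r c i‖} ≤ ENNReal.ofReal (108 * Θ / (m * D ^ 2)) := by
  set A := {c : Config (N + 1) (Fin 3) T3 | m ≤ (ballCount r c i : ℝ) ∧ D / 2 < ‖ballFluct u₀ r c i‖} with hA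
  have hAm : MeasurableSet A := measurableSet_fluctBad hu r m (D / 2) i
  -- conditional (velocity) bound, uniformly in the positions
  have hvel : ∀ x : Fin (N + 1) → T3, velMeasure u₀ θ₀ x {v | zipConfig (x, v) ∈ A} ≤ ENNReal.ofReal (108 * Θ / (m * D ^ 2)) := by
    intro x
    set B := Finset.univ.filter fun j : Fin (N + 1) => Torus.euclidDist (x j) (x i) ≤ r with hB
    have hcount : ∀ v : Fin (N + 1) → V3, ballCount r (zipConfig (x, v)) i = B.card := fun v => rfl
    set W : (Fin (N + 1) → V3) → V3 := fun v => ((B.card : ℝ)⁻¹) • ∑ j ∈ B, (v j - u₀ (x j)) with hW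
    have hfl : ∀ v : Fin (N + 1) → V3, ballFluct u₀ r (zipConfig (x, v)) i = W v := fun v => rfl
    by_cases hmB : m ≤ B.card
    · have hcard : (0 : ℝ) < B.card := hm.trans_le hmB
      have hBne : B.Nonempty := by rw [← Finset.card_pos]; exact_mod_cast hcard
      have hcoord : ∀ l : Fin 3, velMeasure u₀ θ₀ x {v | D / 2 / 3 < |W v l|} ≤ ENNReal.ofReal (Θ / (B.card * (D / 6) ^ 2)) := by
        intro l
        refine (measure_mono fun v hv => ?_).trans
          (pi_gauss_sum_ge_le (fun j => u₀ (x j)) (fun j => θ₀ (x j)) (fun j => hθ0 _) (fun j => hΘ _) hBne l (by positivity : (0 : ℝ) < D / 6))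
        simp only [mem_setOf_eq, hW, PiLp.smul_apply, WithLp.ofLp_sum, Finset.sum_apply, PiLp.sub_apply, smul_eq_mul] at hv ⊢
        rw [abs_mul, abs_inv, Nat.abs_cast, ← div_eq_inv_mul, lt_div_iff₀ hcard] at hv
        rw [show (B.card : ℝ) * (D / 6) = D / 2 / 3 * B.card by ring]
        exact hv.le
      calc velMeasure u₀ θ₀ x {v | zipConfig (x, v) ∈ A} ≤ velMeasure u₀ θ₀ x {v | D / 2 < ‖W v‖} := measure_mono fun v hv => by have h2 := hv.2; rwa [hfl] at h2
        _ ≤ ∑ l, velMeasure u₀ θ₀ x {v | D / 2 / 3 < |W v l|} := measure_setOf_lt_norm_le _ W (by positivity)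
        _ ≤ ∑ _l : Fin 3, ENNReal.ofReal (Θ / (B.card * (D / 6) ^ 2)) := Finset.sum_le_sum fun l _ => hcoord l
        _ = ENNReal.ofReal (3 * (Θ / (B.card * (D / 6) ^ 2))) := by
            rw [Finset.sum_const, Finset.card_univ, Fintype.card_fin, nsmul_eq_mul, ENNReal.ofReal_mul (by norm_num)]; norm_num
        _ ≤ ENNReal.ofReal (108 * Θ / (m * D ^ 2)) := by
            refine ENNReal.ofReal_le_ofReal ?_
            have hΘ0 : 0 ≤ Θ := (hθ0 (x i)).le.trans (hΘ _)
            rw [show 3 * (Θ / (B.card * (D / 6) ^ 2)) = 108 * Θ / (B.card * D ^ 2) by field_simp; ring]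
            exact div_le_div_of_nonneg_left (by positivity) (by positivity) (mul_le_mul_of_nonneg_right hmB (sq_nonneg _))
    · rw [Set.eq_empty_of_forall_notMem (s := {v : Fin (N + 1) → V3 | zipConfig (x, v) ∈ A}) fun v hv => hmB (by have h1 := hv.1; rwa [hcount] at h1), measure_empty]
      exact zero_le
  -- integrate against the position marginal (total mass one)
  have hpre : ∀ x : Fin (N + 1) → T3, MeasurableSet {v : Fin (N + 1) → V3 | zipConfig (x, v) ∈ A} := fun x =>
    hAm.preimage (measurable_zipConfig.comp (measurable_const.prodMk measurable_id))
  rw [← lintegral_indicator_one hAm, lintegral_localGibbsMeasure ha hθ hu ha0 hθ0 σ N (measurable_one.indicator hAm)]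
  refine (lintegral_mono fun x => mul_le_mul_right ((lintegral_indicator_one (hpre x)).trans_le (hvel x)) _).trans_eq ?_
  rw [lintegral_mul_const' _ _ ENNReal.ofReal_ne_top, lintegral_posWeight_eq_one ha hθ hu ha0 hθ0 σ N, one_mul]

/-- **Union bound / Tonelli.** If `f ≤ Σ_{k∈S} (A_k + (N+1)⁻¹ Σ_i 1_{E k i})` with measurable `E k i`, `P(E k i) ≤ B_k`, `P` a probability: `∫ f dP ≤ Σ_{k∈S} (A_k + B_k)`. -/
theorem lintegral_ofReal_le_of_indicator_bound {α : Type*} [MeasurableSpace α] (P : Measure α) [IsProbabilityMeasure P] (N : ℕ) (S : Finset ℕ)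
    (E : ℕ → Fin (N + 1) → Set α) (hE : ∀ k i, MeasurableSet (E k i)) (A Bd : ℕ → ℝ) (hA : ∀ k, 0 ≤ A k) (hB : ∀ k, 0 ≤ Bd k)
    (hPE : ∀ k ∈ S, ∀ i, P (E k i) ≤ ENNReal.ofReal (Bd k)) (f : α → ℝ) (hf : ∀ c, f c ≤ ∑ k ∈ S, (A k + ((N : ℝ) + 1)⁻¹ * ∑ i, (E k i).indicator 1 c)) :
    ∫⁻ c, ENNReal.ofReal (f c) ∂P ≤ ENNReal.ofReal (∑ k ∈ S, (A k + Bd k)) := by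
  have hnn : ∀ k i c, (0 : ℝ) ≤ (E k i).indicator 1 c := fun k i c => Set.indicator_nonneg (fun _ _ => zero_le_one) _
  have hpt : ∀ c, ENNReal.ofReal (f c) ≤ ∑ k ∈ S, (ENNReal.ofReal (A k) + ENNReal.ofReal (((N : ℝ) + 1)⁻¹) * ∑ i, (E k i).indicator 1 c) := by
    intro c
    refine (ENNReal.ofReal_le_ofReal (hf c)).trans_eq ?_
    rw [ENNReal.ofReal_sum_of_nonneg fun k _ => add_nonneg (hA k) (mul_nonneg (by positivity) (Finset.sum_nonneg fun i _ => hnn k i c))]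
    refine Finset.sum_congr rfl fun k _ => ?_
    rw [ENNReal.ofReal_add (hA k) (mul_nonneg (by positivity) (Finset.sum_nonneg fun i _ => hnn k i c)), ENNReal.ofReal_mul (by positivity),
      ENNReal.ofReal_sum_of_nonneg fun i _ => hnn k i c]
    congr 2
    exact Finset.sum_congr rfl fun i _ => by by_cases hc : c ∈ E k i <;> simp [hc]
  have hmeasI : ∀ k i, Measurable fun c => (E k i).indicator (1 : α → ℝ≥0∞) c := fun k i => measurable_one.indicator (hE k i)
  have hmeasS : ∀ k, Measurable fun c => ∑ i, (E k i).indicator (1 : α → ℝ≥0∞) c := fun k => Finset.measurable_sum _ fun i _ => hmeasI k i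
  have hone : ENNReal.ofReal (((N : ℝ) + 1)⁻¹) * ((N + 1 : ℕ) : ℝ≥0∞) = 1 := by
    rw [← ENNReal.ofReal_natCast, ← ENNReal.ofReal_mul (by positivity)]; push_cast; rw [inv_mul_cancel₀ (by positivity), ENNReal.ofReal_one]
  calc ∫⁻ c, ENNReal.ofReal (f c) ∂P ≤ ∫⁻ c, ∑ k ∈ S, (ENNReal.ofReal (A k) + ENNReal.ofReal (((N : ℝ) + 1)⁻¹) * ∑ i, (E k i).indicator 1 c) ∂P := lintegral_mono hpt
    _ = ∑ k ∈ S, (ENNReal.ofReal (A k) + ENNReal.ofReal (((N : ℝ) + 1)⁻¹) * ∑ i, P (E k i)) := by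
        rw [lintegral_finsetSum _ fun k _ => ((hmeasS k).const_mul _).const_add _]
        refine Finset.sum_congr rfl fun k _ => ?_
        rw [lintegral_add_left measurable_const, lintegral_const, measure_univ, mul_one, lintegral_const_mul _ (hmeasS k), lintegral_finsetSum _ fun i _ => hmeasI k i]
        congr 2
        exact Finset.sum_congr rfl fun i _ => lintegral_indicator_one (hE k i)
    _ ≤ ∑ k ∈ S, (ENNReal.ofReal (A k) + ENNReal.ofReal (((N : ℝ) + 1)⁻¹) * ∑ _i : Fin (N + 1), ENNReal.ofReal (Bd k)) := by
        refine Finset.sum_le_sum fun k hk => ?_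
        gcongr with i
        exact hPE k hk _
    _ = ∑ k ∈ S, (ENNReal.ofReal (A k) + ENNReal.ofReal (Bd k)) := by
        refine Finset.sum_congr rfl fun k _ => ?_
        rw [Finset.sum_const, Finset.card_univ, Fintype.card_fin, nsmul_eq_mul, ← mul_assoc, hone, one_mul]
    _ = ENNReal.ofReal (∑ k ∈ S, (A k + Bd k)) := by
        rw [ENNReal.ofReal_sum_of_nonneg fun k _ => add_nonneg (hA k) (hB k)]; exact Finset.sum_congr rfl fun k _ => (ENNReal.ofReal_add (hA k) (hB k)).symm

/-- **Choice of `r₀`**: a continuous field on the compact torus oscillates by `≤ η` below some radius `r₀ ∈ (0, 1]` (uniform continuity; sup-distance `≤` minimal-image distance). -/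
theorem exists_radius_of_continuous {u₀ : T3 → V3} (hu : Continuous u₀) {η : ℝ} (hη : 0 < η) :
    ∃ r₀ : ℝ, 0 < r₀ ∧ r₀ ≤ 1 ∧ ∀ x y : T3, Torus.euclidDist x y ≤ r₀ → ‖u₀ x - u₀ y‖ ≤ η := by
  obtain ⟨δ, hδ, h⟩ := Metric.uniformContinuous_iff.1 (CompactSpace.uniformContinuous_of_continuous hu) η hη
  refine ⟨min (δ / 2) 1, by positivity, min_le_right _ _, fun x y hxy => ?_⟩
  have hd : dist x y < δ :=
    calc dist x y = ‖x - y‖ := dist_eq_norm x y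
      _ ≤ Torus.euclidDist x y := Torus.norm_sub_le_euclidDist_holds x y
      _ < δ := hxy.trans_lt ((min_le_left _ _).trans_lt (by linarith))
  simpa only [dist_eq_norm] using (h hd).le

/-- **Static drift tails of the local Gibbs law** (time-zero instance of `MesoDriftTails`): for continuous profiles `a₀, θ₀ > 0`, `u₀`, every
`σ < 1/2`, every drift level `D₀ > 0` there is `r₀ > 0` such that for every `ε > 0`, once `κ ≥ κ₀(ε, D₀, θ₀)`, the local-Gibbs mean of the
fraction of drift-bad particles (`DriftBad κ r₀ D₀ u₀`) is `≤ ε` for all `N`. Registered support signature of line Sketch, crux ClampedTransferDock. -/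
theorem localGibbs_driftBad_fraction_small : ∀ (a₀ θ₀ : T3 → ℝ) (u₀ : T3 → V3), Continuous a₀ → Continuous θ₀ → Continuous u₀ →
    (∀ x, 0 < a₀ x) → (∀ x, 0 < θ₀ x) → ∃ σ₀ : ℝ, 0 < σ₀ ∧ ∀ σ : ℝ, 0 < σ → σ < σ₀ →
    ∀ Φ : (N : ℕ) → HardSphereFlow (Torus.geometry (Fin 3)) (hsDiameter σ N) (N + 1), ∀ D₀ : ℝ, 0 < D₀ →
    ∃ r₀ : ℝ, 0 < r₀ ∧ ∀ ε : ℝ, 0 < ε → ∃ κ₀ : ℝ, 0 < κ₀ ∧ ∀ κ : ℝ, κ₀ ≤ κ → ∃ N₀ : ℕ, ∀ N : ℕ, N₀ ≤ N →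
      ∫⁻ z, ENNReal.ofReal (((N : ℝ) + 1)⁻¹ * ∑ i : Fin (N + 1), (if DriftBad κ r₀ D₀ u₀ z i then (1 : ℝ) else 0))
        ∂(localGibbsLaw σ a₀ u₀ θ₀ N (Φ N)) ≤ ENNReal.ofReal ε := by
  intro a₀ θ₀ u₀ ha hθ hu ha0 hθ0
  refine ⟨1 / 2, by norm_num, fun σ _ hσ2 Φ D₀ hD₀ => ?_⟩
  obtain ⟨r₀, hr₀, hr₀1, hb⟩ := exists_radius_of_continuous hu (half_pos hD₀)
  obtain ⟨Θ, hΘ0, hΘ⟩ := exists_forall_abs_le_of_continuous hθ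
  have hΘ' : ∀ x, θ₀ x ≤ Θ := fun x => (le_abs_self _).trans (hΘ x)
  refine ⟨r₀, hr₀, fun ε hε => ?_⟩
  set C : ℝ := 250 + 216 * Θ / D₀ ^ 2 with hC
  have hCpos : 0 < C := by positivity
  refine ⟨max 1 (C / ε), lt_max_of_lt_left one_pos, fun κ hκ0 => ⟨0, fun N _ => ?_⟩⟩
  have hκ1 : 1 ≤ κ := (le_max_left _ _).trans hκ0; have hκ : 0 < κ := one_pos.trans_le hκ1
  haveI := isProbabilityMeasure_localGibbsMeasure ha hθ hu ha0 hθ0 hσ2.le N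
  rw [localGibbsLaw_eq]
  obtain ⟨K, hK⟩ := exists_scaleBound hκ N r₀
  set A : ℕ → ℝ := fun k => 125 / (κ * 2 ^ k) with hAdef
  set Bd : ℕ → ℝ := fun k => 108 * Θ / (κ ^ 2 * 4 ^ k * D₀ ^ 2) with hBd
  -- (1)+(2): pointwise reduction and the deterministic sparse count
  have step1 : ∀ c : Config (N + 1) (Fin 3) T3, ((N : ℝ) + 1)⁻¹ * ∑ i : Fin (N + 1), (if DriftBad κ r₀ D₀ u₀ c i then (1 : ℝ) else 0) ≤
      ∑ k ∈ Finset.range K, (A k + ((N : ℝ) + 1)⁻¹ * ∑ i, (fluctEvt κ D₀ u₀ N k i).indicator 1 c) := by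
    intro c
    have hN : (0 : ℝ) < (N : ℝ) + 1 := by positivity
    calc ((N : ℝ) + 1)⁻¹ * ∑ i : Fin (N + 1), (if DriftBad κ r₀ D₀ u₀ c i then (1 : ℝ) else 0)
        ≤ ((N : ℝ) + 1)⁻¹ * ∑ i : Fin (N + 1), ∑ k ∈ Finset.range K, ((sparseEvt κ r₀ N k i).indicator 1 c + (fluctEvt κ D₀ u₀ N k i).indicator 1 c) :=
          mul_le_mul_of_nonneg_left (Finset.sum_le_sum fun i _ => ite_driftBad_le hκ hb hK c i) (by positivity)
      _ = ∑ k ∈ Finset.range K, (((N : ℝ) + 1)⁻¹ * ∑ i : Fin (N + 1), (sparseEvt κ r₀ N k i).indicator 1 c +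
            ((N : ℝ) + 1)⁻¹ * ∑ i, (fluctEvt κ D₀ u₀ N k i).indicator 1 c) := by
          rw [Finset.sum_comm, Finset.mul_sum]; exact Finset.sum_congr rfl fun k _ => by rw [Finset.sum_add_distrib, mul_add]
      _ ≤ ∑ k ∈ Finset.range K, (A k + ((N : ℝ) + 1)⁻¹ * ∑ i, (fluctEvt κ D₀ u₀ N k i).indicator 1 c) := by
          refine Finset.sum_le_sum fun k _ => add_le_add ?_ le_rfl
          rw [inv_mul_le_iff₀ hN]; exact sum_indicator_sparse_le hκ hr₀1 N k c
  -- (3)+(4): integrate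
  have step2 := lintegral_ofReal_le_of_indicator_bound (localGibbsMeasure σ a₀ u₀ θ₀ N) N (Finset.range K) (fluctEvt κ D₀ u₀ N)
    (fun k i => measurableSet_fluctBad hu _ _ _ i) A Bd (fun k => by positivity) (fun k => by positivity)
    (fun k _ i => measure_fluctBad_le ha hθ hu (fun x => (ha0 x).le) hθ0 hΘ' σ N _ (by positivity) hD₀ i) _ step1
  refine step2.trans (ENNReal.ofReal_le_ofReal ?_)
  -- the geometric tail
  have hterm : ∀ k, A k + Bd k ≤ C / κ / 2 * (1 / 2) ^ k := by
    intro k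
    have h42 : (2 : ℝ) ^ k ≤ 4 ^ k := pow_le_pow_left₀ (by norm_num) (by norm_num) k
    have hBd' : Bd k ≤ 108 * Θ / (κ * 2 ^ k * D₀ ^ 2) := div_le_div_of_nonneg_left (by positivity) (by positivity)
      (mul_le_mul_of_nonneg_right (mul_le_mul (by nlinarith : κ ≤ κ ^ 2) h42 (by positivity) (by positivity)) (sq_nonneg _))
    have h12 : (1 / 2 : ℝ) ^ k = (2 ^ k)⁻¹ := by rw [div_pow, one_pow, one_div]
    rw [h12, show C / κ / 2 * (2 ^ k)⁻¹ = 125 / (κ * 2 ^ k) + 108 * Θ / (κ * 2 ^ k * D₀ ^ 2) by rw [hC]; field_simp; ring]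
    exact add_le_add le_rfl hBd'
  calc ∑ k ∈ Finset.range K, (A k + Bd k) ≤ ∑ k ∈ Finset.range K, C / κ / 2 * (1 / 2) ^ k := Finset.sum_le_sum fun k _ => hterm k
    _ = C / κ / 2 * ∑ k ∈ Finset.range K, (1 / 2) ^ k := by rw [Finset.mul_sum]
    _ ≤ C / κ / 2 * 2 := mul_le_mul_of_nonneg_left (sum_geometric_two_le K) (by positivity)
    _ = C / κ := by ring
    _ ≤ ε := by rw [div_le_iff₀ hκ, mul_comm]; exact (div_le_iff₀ hε).1 ((le_max_right _ _).trans hκ0)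

end Summit.AtomisticToContinuum.HydrodynamicLimit.Theorems.ClampedTransferDockBridge

end
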